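import Summits.ResolutionOfSingularities.ResolutionOfSingularities.Theorems.MarkedTransferCampaignW46MohWindowShadeAnchorWalk
import Summits.ResolutionOfSingularities.ResolutionOfSingularities.Theorems.MarkedTransferCampaignW46MohWindowShadePolyStatement
import HarnessLib

/-!
# [OURS · L1 W4.6 rung (iii)] RUNG (iii) for the POLYNOMIAL purely inseparable surface window, CLOSED BY NAME over algebraically closed fields:
# `CampaignW46.MohWindowSurfacePolyPermissiblyTerminates p K`

Cell `res-hironaka`, LADDER-RESOLUTION rung L (D-0089), slot W4.6 rung (iii) «purely inseparable `z^p = f(x, y)` with `ord f < 2p`»; seat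
res-L1-s46-pv-6 (gen 4). Host route MarkedTransfer, `--supports stmt-ResolutionOfSingularities-16155 --as helper`; kind proof (no definition).

THE CLOSER. `mohWindowSurfacePolyPermissiblyTerminates_of_isAlgClosed (p) (K) [IsAlgClosed K] : MohWindowSurfacePolyPermissiblyTerminates p K`
— there is NO infinite §2.1-permissible sequence of the typed Th. 16.6 procedure's ambient data all of whose stages lie in
`Regime.mohWindowSurfacePoly` (o1's regime `regimeMohWindowSurfaceInsep` — isolated singular locus, window germ of exponent `p` at every
singular point — with a POLYNOMIAL purely inseparable presentation `z^p + F(x, y)` at every singular point, `…MohWindowShadePolyStatement.lean`);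
hence the typed rungs `Terminates N Rd` / `TerminatesNabla N Rd` on that regime for EVERY notion instance and reading
(`terminates_mohWindowSurfacePoly_of_isAlgClosed`). ASSEMBLY: an infinite sequence in a regime with isolated singular locus carries a hit thread
(res-L1-s46-pv-1 `PermissibleRun.nonempty_hitThread`, `permissiblyTerminates_of_noHitThread`); the stage-`0` polynomial presentation at the
thread's root is an anchor; `…MohWindowShadeAnchorWalk.false_of_hitThread_anchor` (this seat: entrance door + gen-3 termination theorem +
res-D-pv-050's exit door).

WHAT IS NOT CLAIMED: o1's full rung `MohWindowSurfaceInsepPermissiblyTerminates` (germs `z^p + f` with `f` NOT a polynomial in a regular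
system of parameters, and non-closed base fields, are outside this file); nothing about the manuscript.
HONEST FRAMING. Nothing here is a statement of H. Hironaka's manuscript [Hironaka2017] (2017-03-23; Th. 16.6 p.84, Th. 16.13 p.87 — scope
only, under adjudication) and nothing asserts that any statement of it holds. AI-written; AI review is weaker than expert review. No
`sorry`; axioms standard. [folklore]
-/

noncomputable section

set_option linter.dupNamespace false -- mandated namespace of this single-conjunct summit

open CategoryTheory AlgebraicGeometry TopologicalSpace IsLocalRing MvPolynomial

namespace Summit.ResolutionOfSingularities.ResolutionOfSingularities.Theorems

namespace CampaignW46

open Literature.AlgebraicGeometry.Resolution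
open Literature.AlgebraicGeometry.Hironaka2017.S02Preliminaries
open Literature.AlgebraicGeometry.Hironaka2017.Datum

universe u

variable (p : ℕ) [Fact p.Prime] (K : Type u) [Field K] [CharP K p]

/-- **STAGE-0 FORM (stronger than the sub-regime rung).** [OURS · L1 W4.6 rung (iii)] NOT a statement of the manuscript. Over an
algebraically closed field there is NO infinite §2.1-permissible sequence inside o1's regime of record `regimeMohWindowSurfaceInsep` whose
INITIAL singular points carry polynomial purely inseparable presentations (`MohWindowSurfacePolyAt` at stage `0` only): such a sequence
has a hit thread (res-L1-s46-pv-1's König extraction, isolated singular locus) rooted at an anchored point. [cite: StacksProject, Tag 0CY7] -/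
theorem false_of_permissibleRun_insep_polyStart [IsAlgClosed K] (r : PermissibleRun p K)
    (hr : ∀ k, regimeMohWindowSurfaceInsep (p := p) (K := K) (r.A k) (r.E k))
    (h0 : ∀ ξ ∈ (r.E 0).sing, MohWindowSurfacePolyAt p (germConst (r.A 0) ξ) (stalkIdeal (r.E 0).J ξ)) : False := by
  classical
  obtain ⟨t⟩ := r.nonempty_hitThread fun k => ((regimeMohWindowSurfaceInsep_iff _ _).mp (hr k)).1.1
  obtain ⟨-, -, x, y, z, hxyz, F, hclean, -, -, hI⟩ := h0 (t.y 0) (t.mem 0)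
  refine MohWindowShadeAnchorWalk.false_of_hitThread_anchor (fun A ξ => germConst A ξ)
    (fun A A' π h ξ' l => MohWindowShadeAnchorWalk.stalkMap_germ_sectionConst π h ξ' l)
    (fun A ξ hξ ρ => MohWindowShadeAnchorWalk.exists_sub_germ_sectionConst_mem A hξ ρ) r hr t F hclean
    ⟨x, y, z, hxyz, ?_⟩
  rw [hI, vec2_eq_frame]

/-- **No hit thread in the polynomial surface window regime** (algebraically closed `K`). [OURS · L1 W4.6 rung (iii)] NOT a statement of
the manuscript. [cite: StacksProject, Tag 0CY7] -/
theorem mohWindowSurfacePoly_noHitThread [IsAlgClosed K] : NoHitThread (Regime.mohWindowSurfacePoly (p := p) (K := K)) := by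
  classical
  intro r hr t
  obtain ⟨-, -, x, y, z, hxyz, F, hclean, -, -, hI⟩ := (hr 0).2 (t.y 0) (t.mem 0)
  refine MohWindowShadeAnchorWalk.false_of_hitThread_anchor (fun A ξ => germConst A ξ)
    (fun A A' π h ξ' l => MohWindowShadeAnchorWalk.stalkMap_germ_sectionConst π h ξ' l)
    (fun A ξ hξ ρ => MohWindowShadeAnchorWalk.exists_sub_germ_sectionConst_mem A hξ ρ) r (fun k => (hr k).1) t F hclean
    ⟨x, y, z, hxyz, ?_⟩
  rw [hI, vec2_eq_frame]

/-- **RUNG (iii), POLYNOMIAL PURELY INSEPARABLE SURFACE WINDOW — CLOSED BY NAME over algebraically closed fields.** [OURS · L1 W4.6 rung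
(iii)] NOT a statement of the manuscript: `MohWindowSurfacePolyPermissiblyTerminates p K` — no infinite §2.1-permissible sequence inside
`Regime.mohWindowSurfacePoly`. [cite: Hauser2010, §F (setting f = x^p + y^r g)] [cite: StacksProject, Tag 0CY7] -/
theorem mohWindowSurfacePolyPermissiblyTerminates_of_isAlgClosed [IsAlgClosed K] : MohWindowSurfacePolyPermissiblyTerminates p K :=
  permissiblyTerminates_of_noHitThread (fun A E h => ((regimeMohWindowSurfaceInsep_iff A E).mp h.1).1.1)
    (mohWindowSurfacePoly_noHitThread p K)

/-- **The typed rungs**: over an algebraically closed field, for EVERY notion instance `N` and reading `Rd`, the typed Th. 16.6 procedure with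
the literal centre rule (`Terminates`) and the ∇-centred one (`TerminatesNabla`) have no infinite run inside `Regime.mohWindowSurfacePoly`.
[OURS · L1 W4.6 rung (iii)] NOT a statement of the manuscript. [folklore] -/
theorem terminates_mohWindowSurfacePoly_of_isAlgClosed [IsAlgClosed K] (n : ℕ) (N : Notions.{u} n) (Rd : Reading p K N) :
    Terminates N Rd (Regime.mohWindowSurfacePoly (p := p) (K := K)) ∧
      TerminatesNabla N Rd (Regime.mohWindowSurfacePoly (p := p) (K := K)) :=
  terminates_and_terminatesNabla_of_mohWindowSurfacePolyPermissiblyTerminates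
    (mohWindowSurfacePolyPermissiblyTerminates_of_isAlgClosed p K) n N Rd

end CampaignW46

end Summit.ResolutionOfSingularities.ResolutionOfSingularities.Theorems

end
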